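import Summits.QuantumFields.YangMills.Theorems.BalabanUVNodesN21TwoRunDeviceOfBgCloseness

/-!
# N21 (NE7c) · THE CONSUMER's JUNCTION AT THE RESUMMED (3.2)⊗(3.3)⊗ζ LEVEL: design (i)'s two-run CORE of the top step weight lies between dag-n21-d's gapped step weight
# `wGapAt θlo θhi` and the top-lettered step weight `wTopAt θ`, POINTWISE in `(s′, U, V′)` of run A with run B's top field `V′_B` a free parameter

Track A of `YM-PLAN.md` (cell `pub-ymgap`), node **N21** (NE7c, NOT PRINTED); WIDTH SEAT `pub-ymgap-dag-n21-w2` (gen 3), file 5 (ASK-NEXT-1 (a)).  THEOREMS ONLY: 0 `def`, 0 `sorry`;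
COUNT-NEUTRAL; `--kind proof --supports stmt-QuantumFields-27366 --as helper` (K3⁸ `SpineGivenEndpointR13SepCoPHV`, dag-lead KEY MAP v2).  Imports this seat's file 3
`…N21TwoRunDeviceOfBgCloseness` (p625475 ✓; through it files 1–2, dag-n21-d's U1∕U2∕U5 (`wGapAt`, `wGapAt_apply`, `wTopAt_apply`, `ωGapAt`, `aGapAt_of_not_subset`), T1 (`wTopAt`,
`topLetter_top`), def-T FILE 19 (`ωOfRecordAt`, `aWeightAt`, `bWeightAt`, `aWeightAt_nonneg`, `bWeightAt_nonneg`, `twoDeltaLetterOfRecord`) and FILE 2 (`resumWeights`, `σOfRecord`)).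
No Theses import; restates nothing; the two-run core is written INLINE with def-T's `resumWeights` (no new object minted — that would be the lane's definition desk).

WHY (dag-n21-w2 ASK-NEXT-1 (a), l.35901; dag-lead g17 l.36107 «silence by 10:50Z ⇒ (c) then (a)»).  Files 1∕3 compare, for ONE (3.2) label `P`, run A's weight `a|_θ(P)(V′)`, its
two-run common-refinement core (run B's factors read through `ι` at run B's top field `V′_B`) and dag-n21-d's gapped weight `aGapAt θlo θhi s P V′`.  The top step weight of a
(2.18) history is the RESUMMATION over the labels `t = (P, Q, (R, S))` with `σ s t = s′` of `a|_θ(P)(V′) · b|_{2δ_k}(P, Q)(U, V′) · ζ(t)(U, V′)` (def-T `resumWeights ∘ ωOfRecordAt`;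
dag-n21-d's `wTopAt θ` ∕ `wGapAt θlo θhi` are the instances with `a|_θ` ∕ `aGapAt`).  THIS FILE resums the comparison: with the SAME `b`, `ζ` factors (nonnegative under the record's
row `0 ≤ ζ`), the two-run core weight `Σ_t [core_{P_t}(V′, V′_B)] · b · ζ` lies ABOVE `wGapAt θlo θhi (s′)(U, V′)` (two-way background closeness through `ι`, collar clearing `Δ`)
and BELOW `wTopAt θ (s′)(U, V′)` (always, at the top step `k + 1 = p.K`) — so design (i)'s resummed deficit `wTopAt θ − core` is at most the gapped deficit `wTopAt θ − wGapAt θlo θhi`,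
the integrand of dag-n21-d's two-sided collar shell (`topGapShellAt_eq_graph`, U2) before the old front factor, the dressed slot and the transport — all of which are run A's alone and
nonnegative.  POINTWISE ONLY: the integrated comparison needs the joint law of `(V′, V′_B)` (U5 design (i)'s object; dag-n20-c g18 l.≈35903: not in the tree).

WHAT IS PROVED ([bookkeeping] BY NAME).
* ★★ `wGapAt_le_twoRunCore_of_bgClose` — `wGapAt ϑ θlo θhi p g k s′ U V′ ≤ resumWeights σ (two-run core · b · ζ) s′ U V′` (rows: `0 ≤ ζ`; hypotheses: `0 ≤ Δ`, two-way domination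
  through `ι`, `θlo + Δ ≤ θ ≤ θhi − Δ`).
* ★ `twoRunCore_le_wTopAt` — `resumWeights σ (two-run core · b · ζ) s′ U V′ ≤ wTopAt ϑ θ p g k s′ U V′` at the top step `k + 1 = p.K` (row `0 ≤ ζ` only).
* ★★ `wTopAt_sub_twoRunCore_le_wTopAt_sub_wGapAt_of_bgClose` and `twoRunCore_nonneg` — the deficit form and the sign.

HONEST FRAMING.  Pointwise bookkeeping; closeness ∕ `ι` ∕ collar DISPLAYED (N16's, the consumer's); `V′_B` a free parameter (no joint law); nothing of Bałaban's asserted; NE7c NOT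
PRINTED ∕ NOT proved; **N21 NOT discharged**; K3⁷∕K3⁸ NOT claimed; counts UNMOVED (typed 28∕28 · discharged 5∕27); never a count claim.  One finite four-torus programme at fixed `ε` —
NOT ℝ⁴, NOT OS, NOT a mass gap, NOT the Clay problem.  No decl below carries a cite tag.
-/

open Finset

namespace Summit.QuantumFields.YangMills.Theorems.N21GappedCollarDesignIResummed

open Literature.MathematicalPhysics.QuantumFieldTheory.Balaban1983to89
open Literature.MathematicalPhysics.QuantumFieldTheory.Balaban1983to89.T4Continuum
open Literature.MathematicalPhysics.QuantumFieldTheory.Balaban1983to89.Node00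
open B14.Eq216Concrete (ukBox)
open GaugeField (plaqHol)
open GaugeGroup (dist1)
open Summit.QuantumFields.YangMills.Theorems.N21ShellSplitOfRecord13CoPH
  (aGapAt aGapAt_of_not_subset ωGapAt wGapAt wGapAt_apply wTopAt wTopAt_apply topLetter topLetter_top)
open Summit.QuantumFields.YangMills.Theorems.N21GappedCollarDesignI (core_le_aWeightAt)
open Summit.QuantumFields.YangMills.Theorems.N21TwoRunDevice (aGapAt_le_core_of_bgClose)

variable (F : T4Family) (N : ℕ) [NeZero N] (ϑ : Stage9Params F N)

/-- ★★ **THE GAPPED STEP WEIGHT LIES BELOW THE TWO-RUN CORE WEIGHT.**  Run A's data `(p, g, k)`, a top history `s′`, fields `(U, V′)`; run B's data `(p′, g′, k′)` and top field `V′_B`;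
a site identification `ι`; two-way plaquette-wise domination of the local backgrounds in threshold units up to `Δ ≥ 0`; a collar `θlo + Δ ≤ θ ≤ θhi − Δ`; the record's row `0 ≤ ζ`.
Then `wGapAt θlo θhi (s′)(U, V′) ≤ Σ_{t : σ s t = s′} [core_{P_t}] · b|_{2δ_k}(P_t, Q_t)(U, V′) · ζ(t)(U, V′)`, the two-run core weight written with def-T's `resumWeights` and the guard
`[P_t ⊆ cubes32 s]` of the (3.2) range (FILE 3 `aGapAt_le_core_of_bgClose` label by label; `aGapAt_of_not_subset` off the range). [bookkeeping] -/
theorem wGapAt_le_twoRunCore_of_bgClose (hζ0 : ∀ p g k s Pl Ql RS U V', 0 ≤ ϑ.ζ p g k s Pl Ql RS U V')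
    {p p' : B12.RunParams} {g g' : ℕ → ℝ} {k k' : ℕ} (ι : Iχ F ϑ.ν p g k → Iχ F ϑ.ν p' g' k')
    (s' : SeqOfRecord F ϑ.ν ϑ.τ9.M g p.K (k + 1)) (U : GaugeField (F.P p.K) k (SU N)) (V' : GaugeField (F.P p.K) (k + 1) (SU N))
    (VB : GaugeField (F.P p'.K) (k' + 1) (SU N)) {Δ : ℝ} (hΔ : 0 ≤ Δ)
    (hAB : ∀ c : Iχ F ϑ.ν p g k, ∀ q' ∈ plaqInside (cubeEnl (F.P p'.K) (sideχ F ϑ.ν p' g' k') (ι c) 1), ∃ q ∈ plaqInside (cubeEnl (F.P p.K) (sideχ F ϑ.ν p g k) c 1),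
      dist1 (plaqHol (ukBox (bgOfRecord (avOfRecord F N p'.K) {U | PlaqSmall (ϑ.ν.εreg * (F.P p'.K).eta (k' + 1) ^ 2) U}) ϑ.ν.M₁
          (cubeEnl (F.P p'.K) (sideχ F ϑ.ν p' g' k') (ι c) 4) (k' + 1) VB) q') / (F.P p'.K).eta (k' + 1) ^ 2 ≤
        dist1 (plaqHol (ukBox (bgOfRecord (avOfRecord F N p.K) {U | PlaqSmall (ϑ.ν.εreg * (F.P p.K).eta (k + 1) ^ 2) U}) ϑ.ν.M₁
          (cubeEnl (F.P p.K) (sideχ F ϑ.ν p g k) c 4) (k + 1) V') q) / (F.P p.K).eta (k + 1) ^ 2 + Δ)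
    (hBA : ∀ c : Iχ F ϑ.ν p g k, ∀ q ∈ plaqInside (cubeEnl (F.P p.K) (sideχ F ϑ.ν p g k) c 1), ∃ q' ∈ plaqInside (cubeEnl (F.P p'.K) (sideχ F ϑ.ν p' g' k') (ι c) 1),
      dist1 (plaqHol (ukBox (bgOfRecord (avOfRecord F N p.K) {U | PlaqSmall (ϑ.ν.εreg * (F.P p.K).eta (k + 1) ^ 2) U}) ϑ.ν.M₁
          (cubeEnl (F.P p.K) (sideχ F ϑ.ν p g k) c 4) (k + 1) V') q) / (F.P p.K).eta (k + 1) ^ 2 ≤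
        dist1 (plaqHol (ukBox (bgOfRecord (avOfRecord F N p'.K) {U | PlaqSmall (ϑ.ν.εreg * (F.P p'.K).eta (k' + 1) ^ 2) U}) ϑ.ν.M₁
          (cubeEnl (F.P p'.K) (sideχ F ϑ.ν p' g' k') (ι c) 4) (k' + 1) VB) q') / (F.P p'.K).eta (k' + 1) ^ 2 + Δ)
    {θlo θ θhi : ℝ} (hlo : θlo + Δ ≤ θ) (hhi : θ + Δ ≤ θhi) :
    wGapAt F N ϑ θlo θhi p g k s' U V' ≤
      resumWeights (σOfRecord F ϑ.ν ϑ.τ9.M p g k)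
        (fun s t U V' =>
          (if t.1 ⊆ cubes32 F ϑ.ν ϑ.τ9.M p g k s then
              (∏ c ∈ cubes32 F ϑ.ν ϑ.τ9.M p g k s \ t.1, (chiFactorAt F N ϑ.ν p g k θ c V' * chiFactorAt F N ϑ.ν p' g' k' θ (ι c) VB)) *
                ∏ c ∈ t.1, ((1 - chiFactorAt F N ϑ.ν p g k θ c V') * (1 - chiFactorAt F N ϑ.ν p' g' k' θ (ι c) VB))
            else 0) *
            bWeightAt F N ϑ.ν ϑ.τ9.M p g k (twoDeltaLetterOfRecord ϑ.ν ϑ.A₁ p g k) s t.1 t.2.1 U V' * ϑ.ζ p g k s t.1 t.2.1 t.2.2 U V')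
        s' U V' := by
  classical
  rw [wGapAt_apply]
  unfold resumWeights
  refine Finset.sum_le_sum fun t _ => ?_
  dsimp only [ωGapAt]
  have hb := bWeightAt_nonneg F N ϑ.ν ϑ.τ9.M p g k (twoDeltaLetterOfRecord ϑ.ν ϑ.A₁ p g k) s'.init t.1 t.2.1 U V'
  have hz := hζ0 p g k s'.init t.1 t.2.1 t.2.2 U V'
  by_cases hP : t.1 ⊆ cubes32 F ϑ.ν ϑ.τ9.M p g k s'.init
  · rw [if_pos hP]
    have h := aGapAt_le_core_of_bgClose F N ϑ.ν ϑ.τ9.M ι V' VB hΔ hAB hBA hlo hhi s'.init hP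
    exact mul_le_mul_of_nonneg_right (mul_le_mul_of_nonneg_right h hb) hz
  · rw [if_neg hP, aGapAt_of_not_subset F N ϑ.ν ϑ.τ9.M p g k θlo θhi s'.init hP V']

/-- **THE TWO-RUN CORE WEIGHT IS NONNEGATIVE** (row `0 ≤ ζ`). [bookkeeping] -/
theorem twoRunCore_nonneg (hζ0 : ∀ p g k s Pl Ql RS U V', 0 ≤ ϑ.ζ p g k s Pl Ql RS U V')
    {p p' : B12.RunParams} {g g' : ℕ → ℝ} {k k' : ℕ} (ι : Iχ F ϑ.ν p g k → Iχ F ϑ.ν p' g' k') (θ : ℝ)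
    (s' : SeqOfRecord F ϑ.ν ϑ.τ9.M g p.K (k + 1)) (U : GaugeField (F.P p.K) k (SU N)) (V' : GaugeField (F.P p.K) (k + 1) (SU N))
    (VB : GaugeField (F.P p'.K) (k' + 1) (SU N)) :
    0 ≤ resumWeights (σOfRecord F ϑ.ν ϑ.τ9.M p g k)
        (fun s t U V' =>
          (if t.1 ⊆ cubes32 F ϑ.ν ϑ.τ9.M p g k s then
              (∏ c ∈ cubes32 F ϑ.ν ϑ.τ9.M p g k s \ t.1, (chiFactorAt F N ϑ.ν p g k θ c V' * chiFactorAt F N ϑ.ν p' g' k' θ (ι c) VB)) *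
                ∏ c ∈ t.1, ((1 - chiFactorAt F N ϑ.ν p g k θ c V') * (1 - chiFactorAt F N ϑ.ν p' g' k' θ (ι c) VB))
            else 0) *
            bWeightAt F N ϑ.ν ϑ.τ9.M p g k (twoDeltaLetterOfRecord ϑ.ν ϑ.A₁ p g k) s t.1 t.2.1 U V' * ϑ.ζ p g k s t.1 t.2.1 t.2.2 U V')
        s' U V' := by
  classical
  unfold resumWeights
  refine Finset.sum_nonneg fun t _ => ?_
  dsimp only
  refine mul_nonneg (mul_nonneg ?_ (bWeightAt_nonneg F N ϑ.ν ϑ.τ9.M p g k _ s'.init t.1 t.2.1 U V')) (hζ0 p g k s'.init t.1 t.2.1 t.2.2 U V')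
  split_ifs
  · exact mul_nonneg
      (prod_nonneg fun c _ => mul_nonneg (chiFactorAt_nonneg F N ϑ.ν p g k θ c V') (chiFactorAt_nonneg F N ϑ.ν p' g' k' θ (ι c) VB))
      (prod_nonneg fun c _ => mul_nonneg (sub_nonneg.2 (chiFactorAt_le_one F N ϑ.ν p g k θ c V')) (sub_nonneg.2 (chiFactorAt_le_one F N ϑ.ν p' g' k' θ (ι c) VB)))
  · exact le_rfl

/-- ★ **THE TWO-RUN CORE WEIGHT LIES BELOW THE TOP-LETTERED STEP WEIGHT** at the top step `k + 1 = p.K` (row `0 ≤ ζ`; no closeness needed: FILE 1 `core_le_aWeightAt` label by label,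
`topLetter_top`). [bookkeeping] -/
theorem twoRunCore_le_wTopAt (hζ0 : ∀ p g k s Pl Ql RS U V', 0 ≤ ϑ.ζ p g k s Pl Ql RS U V')
    {p p' : B12.RunParams} {g g' : ℕ → ℝ} {k k' : ℕ} (hk : k + 1 = p.K) (ι : Iχ F ϑ.ν p g k → Iχ F ϑ.ν p' g' k') (θ : ℝ)
    (s' : SeqOfRecord F ϑ.ν ϑ.τ9.M g p.K (k + 1)) (U : GaugeField (F.P p.K) k (SU N)) (V' : GaugeField (F.P p.K) (k + 1) (SU N))
    (VB : GaugeField (F.P p'.K) (k' + 1) (SU N)) :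
    resumWeights (σOfRecord F ϑ.ν ϑ.τ9.M p g k)
        (fun s t U V' =>
          (if t.1 ⊆ cubes32 F ϑ.ν ϑ.τ9.M p g k s then
              (∏ c ∈ cubes32 F ϑ.ν ϑ.τ9.M p g k s \ t.1, (chiFactorAt F N ϑ.ν p g k θ c V' * chiFactorAt F N ϑ.ν p' g' k' θ (ι c) VB)) *
                ∏ c ∈ t.1, ((1 - chiFactorAt F N ϑ.ν p g k θ c V') * (1 - chiFactorAt F N ϑ.ν p' g' k' θ (ι c) VB))
            else 0) *
            bWeightAt F N ϑ.ν ϑ.τ9.M p g k (twoDeltaLetterOfRecord ϑ.ν ϑ.A₁ p g k) s t.1 t.2.1 U V' * ϑ.ζ p g k s t.1 t.2.1 t.2.2 U V')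
        s' U V' ≤ wTopAt F N ϑ θ p g k s' U V' := by
  classical
  rw [wTopAt_apply]
  have htop : topLetter ϑ.ν θ p g (k + 1) = θ := by rw [hk]; exact topLetter_top ϑ.ν θ p g
  unfold resumWeights
  refine Finset.sum_le_sum fun t _ => ?_
  dsimp only [ωOfRecordAt]
  have hb := bWeightAt_nonneg F N ϑ.ν ϑ.τ9.M p g k (twoDeltaLetterOfRecord ϑ.ν ϑ.A₁ p g k) s'.init t.1 t.2.1 U V'
  have hz := hζ0 p g k s'.init t.1 t.2.1 t.2.2 U V'
  rw [htop]
  refine mul_le_mul_of_nonneg_right (mul_le_mul_of_nonneg_right ?_ hb) hz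
  by_cases hP : t.1 ⊆ cubes32 F ϑ.ν ϑ.τ9.M p g k s'.init
  · rw [if_pos hP]
    exact core_le_aWeightAt F N ϑ.ν ϑ.τ9.M p g k θ s'.init hP V' (fun c θ' => chiFactorAt F N ϑ.ν p' g' k' θ' (ι c) VB)
      (fun c θ' => chiFactorAt_nonneg F N ϑ.ν p' g' k' θ' (ι c) VB) (fun c θ' => chiFactorAt_le_one F N ϑ.ν p' g' k' θ' (ι c) VB)
  · rw [if_neg hP]
    exact aWeightAt_nonneg F N ϑ.ν ϑ.τ9.M p g k θ s'.init t.1 V'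

/-- ★★ **THE RESUMMED JUNCTION, DEFICIT FORM**: design (i)'s resummed deficit of the top step weight is at most dag-n21-d's gapped deficit,
`wTopAt θ (s′)(U,V′) − (two-run core weight) ≤ wTopAt θ (s′)(U,V′) − wGapAt θlo θhi (s′)(U,V′)` — pointwise, under the hypotheses of `wGapAt_le_twoRunCore_of_bgClose`. [bookkeeping] -/
theorem wTopAt_sub_twoRunCore_le_wTopAt_sub_wGapAt_of_bgClose (hζ0 : ∀ p g k s Pl Ql RS U V', 0 ≤ ϑ.ζ p g k s Pl Ql RS U V')
    {p p' : B12.RunParams} {g g' : ℕ → ℝ} {k k' : ℕ} (ι : Iχ F ϑ.ν p g k → Iχ F ϑ.ν p' g' k')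
    (s' : SeqOfRecord F ϑ.ν ϑ.τ9.M g p.K (k + 1)) (U : GaugeField (F.P p.K) k (SU N)) (V' : GaugeField (F.P p.K) (k + 1) (SU N))
    (VB : GaugeField (F.P p'.K) (k' + 1) (SU N)) {Δ : ℝ} (hΔ : 0 ≤ Δ)
    (hAB : ∀ c : Iχ F ϑ.ν p g k, ∀ q' ∈ plaqInside (cubeEnl (F.P p'.K) (sideχ F ϑ.ν p' g' k') (ι c) 1), ∃ q ∈ plaqInside (cubeEnl (F.P p.K) (sideχ F ϑ.ν p g k) c 1),
      dist1 (plaqHol (ukBox (bgOfRecord (avOfRecord F N p'.K) {U | PlaqSmall (ϑ.ν.εreg * (F.P p'.K).eta (k' + 1) ^ 2) U}) ϑ.ν.M₁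
          (cubeEnl (F.P p'.K) (sideχ F ϑ.ν p' g' k') (ι c) 4) (k' + 1) VB) q') / (F.P p'.K).eta (k' + 1) ^ 2 ≤
        dist1 (plaqHol (ukBox (bgOfRecord (avOfRecord F N p.K) {U | PlaqSmall (ϑ.ν.εreg * (F.P p.K).eta (k + 1) ^ 2) U}) ϑ.ν.M₁
          (cubeEnl (F.P p.K) (sideχ F ϑ.ν p g k) c 4) (k + 1) V') q) / (F.P p.K).eta (k + 1) ^ 2 + Δ)
    (hBA : ∀ c : Iχ F ϑ.ν p g k, ∀ q ∈ plaqInside (cubeEnl (F.P p.K) (sideχ F ϑ.ν p g k) c 1), ∃ q' ∈ plaqInside (cubeEnl (F.P p'.K) (sideχ F ϑ.ν p' g' k') (ι c) 1),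
      dist1 (plaqHol (ukBox (bgOfRecord (avOfRecord F N p.K) {U | PlaqSmall (ϑ.ν.εreg * (F.P p.K).eta (k + 1) ^ 2) U}) ϑ.ν.M₁
          (cubeEnl (F.P p.K) (sideχ F ϑ.ν p g k) c 4) (k + 1) V') q) / (F.P p.K).eta (k + 1) ^ 2 ≤
        dist1 (plaqHol (ukBox (bgOfRecord (avOfRecord F N p'.K) {U | PlaqSmall (ϑ.ν.εreg * (F.P p'.K).eta (k' + 1) ^ 2) U}) ϑ.ν.M₁
          (cubeEnl (F.P p'.K) (sideχ F ϑ.ν p' g' k') (ι c) 4) (k' + 1) VB) q') / (F.P p'.K).eta (k' + 1) ^ 2 + Δ)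
    {θlo θ θhi : ℝ} (hlo : θlo + Δ ≤ θ) (hhi : θ + Δ ≤ θhi) :
    wTopAt F N ϑ θ p g k s' U V' -
        resumWeights (σOfRecord F ϑ.ν ϑ.τ9.M p g k)
          (fun s t U V' =>
            (if t.1 ⊆ cubes32 F ϑ.ν ϑ.τ9.M p g k s then
                (∏ c ∈ cubes32 F ϑ.ν ϑ.τ9.M p g k s \ t.1, (chiFactorAt F N ϑ.ν p g k θ c V' * chiFactorAt F N ϑ.ν p' g' k' θ (ι c) VB)) *
                  ∏ c ∈ t.1, ((1 - chiFactorAt F N ϑ.ν p g k θ c V') * (1 - chiFactorAt F N ϑ.ν p' g' k' θ (ι c) VB))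
              else 0) *
              bWeightAt F N ϑ.ν ϑ.τ9.M p g k (twoDeltaLetterOfRecord ϑ.ν ϑ.A₁ p g k) s t.1 t.2.1 U V' * ϑ.ζ p g k s t.1 t.2.1 t.2.2 U V')
          s' U V' ≤
      wTopAt F N ϑ θ p g k s' U V' - wGapAt F N ϑ θlo θhi p g k s' U V' := by
  have h := wGapAt_le_twoRunCore_of_bgClose F N ϑ hζ0 ι s' U V' VB hΔ hAB hBA hlo hhi
  linarith

end Summit.QuantumFields.YangMills.Theorems.N21GappedCollarDesignIResummed
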